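import Summits.MatrixMultiplication.MatrixMultiplication.Theorems.SoloInformedTwistedMatchingsEffectivePrimePow
import Summits.MatrixMultiplication.MatrixMultiplication.Theorems.SoloInformedTwistedMatchingsSylow
import HarnessLib

/-!
# Effective Theorem B″: coprime splitting `S ≅ A × T`, `A` a `p`-group of exponent `p^E`, `p ∤ |T|`

Solo-informed seat (MatrixMultiplication), gen 101; sharpest-statement §2y(8), effective form for general
bounded exponent. `coprimeTwistedMatching_card_le_effective`: the effective counterpart of
`exists_coprimeTwistedMatching_card_le` — with `0 < u ≤ 1`, `c : ℝ` and the level conditions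
`u^{-(p-1)(p+1)^s/3} Σ_{j<p} u^{j(p+1)^s} ≤ p^c` for `s < E`: if `S ≅ A × T`, `A = ∏ ℤ/p^{e_i}`
(`e_i ≤ E`), `gcd(p, |T|) = 1`, then every twisted matching in `S` under any finite family of
automorphism-pair twists has `|ι| ≤ 3 |T| |A|^c`. With the certified level conditions of
`twistedMatching_card_le_exp_two/_three/_four` this makes Theorem B″ effective for every exponent
`m = p^E m'`, `p ∤ m'`, with the saving taken on the `p`-part.
References: BCCGNSU17 (arXiv:1605.06702) §4; CohnUmans2013 (arXiv:1207.6528) §5.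
-/

noncomputable section

open scoped BigOperators
open Finset Literature.Combinatorics.Additive Literature.Barriers.MatrixMultiplication

namespace Summit.MatrixMultiplication.MatrixMultiplication.Theorems.TwistedSliceRank

section EffectiveCoprime

/-- **Effective coprime splitting.** Level conditions at `(p, E, u, c)` give
`|ι| ≤ 3 |T| |A|^c` for twisted matchings in `S ≅ A × T`, `A = ∏ ℤ/p^{e_i}` (`e_i ≤ E`), `p ∤ |T|`.
[this work] -/
theorem coprimeTwistedMatching_card_le_effective (p : ℕ) [hp : Fact p.Prime] (E : ℕ) (u c : ℝ)
    (hu0 : 0 < u) (hu1 : u ≤ 1)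
    (hθ : ∀ s : ℕ, s < E →
      u ^ (-(((p - 1 : ℕ) : ℝ)) * ((p : ℝ) + 1) ^ s / 3) *
        ∑ j : Fin p, u ^ (((j : ℕ) : ℝ) * ((p : ℝ) + 1) ^ s) ≤ (p : ℝ) ^ c)
    (κ : Type) [Fintype κ] [DecidableEq κ] (n e : κ → ℕ)
    [∀ i, NeZero (n i)] (hne : ∀ i, n i = p ^ e i) (heE : ∀ i, e i ≤ E)
    (T : Type) [Group T] [Fintype T] [DecidableEq T] (hT : Nat.Coprime p (Fintype.card T))
    (S : Type) [Group S] [Fintype S] [DecidableEq S]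
    (eS : S ≃* (((i : κ) → Multiplicative (ZMod (n i))) × T))
    (σ : Type) [Fintype σ] (φ ψ : σ → S ≃* S) (ι : Type) [Fintype ι] (x y z : ι → S)
    (hmatch : ∀ i j l : ι, (∃ s : σ, x i * φ s (y j) * ψ s (z l) = 1) ↔ (i = j ∧ j = l)) :
    (Fintype.card ι : ℝ) ≤ 3 * (Fintype.card T : ℝ) *
      (Fintype.card ((i : κ) → Multiplicative (ZMod (n i))) : ℝ) ^ c := by
  classical
  have hp2 : 2 ≤ p := hp.out.two_le
  have hp0 : (0 : ℝ) < p := by exact_mod_cast hp.out.pos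
  obtain ⟨ιA, _, _, C, hCL, hS'⟩ := exists_prodZMod_levelPCGS (p := p) (n := n) (e := e) hne heE
  -- transport the matching along `eS`
  let φ' := fun s => (eS.symm.trans (φ s)).trans eS
  let ψ' := fun s => (eS.symm.trans (ψ s)).trans eS
  have hrel : ∀ (i j l : ι) (s : σ),
      eS (x i) * φ' s (eS (y j)) * ψ' s (eS (z l)) = 1 ↔ x i * φ s (y j) * ψ s (z l) = 1 := by
    intro i j l s
    simp only [φ', ψ', MulEquiv.trans_apply, MulEquiv.symm_apply_apply]
    rw [← map_mul, ← map_mul, eS.map_eq_one_iff]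
  have hmatch' : ∀ i j l : ι,
      (∃ s : σ, eS (x i) * φ' s (eS (y j)) * ψ' s (eS (z l)) = 1) ↔ (i = j ∧ j = l) := by
    intro i j l
    simp_rw [hrel]
    exact hmatch i j l
  -- the field and the weights
  have hinj : Function.Injective
      (algebraMap (Polynomial (ZMod p)) (FractionRing (Polynomial (ZMod p)))) :=
    IsFractionRing.injective (Polynomial (ZMod p)) (FractionRing (Polynomial (ZMod p)))
  haveI : CharP (FractionRing (Polynomial (ZMod p))) p := charP_of_injective_algebraMap hinj p
  haveI : Infinite (FractionRing (Polynomial (ZMod p))) := Infinite.of_injective _ hinj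
  let Sol : ι → Finset σ := fun i => Finset.univ.filter fun s =>
    eS (x i) * φ' s (eS (y i)) * ψ' s (eS (z i)) = 1
  have hSol : ∀ i, (Sol i).Nonempty := fun i => by
    obtain ⟨s, hs⟩ := (hmatch' i i i).2 ⟨rfl, rfl⟩
    exact ⟨s, by simp [Sol, hs]⟩
  obtain ⟨t, ht⟩ := exists_weights (K := FractionRing (Polynomial (ZMod p))) Sol hSol
  have hdiag : ∀ i, (∑ s, t s * (if eS (x i) * φ' s (eS (y i)) * ψ' s (eS (z i)) = 1
      then (1 : FractionRing (Polynomial (ZMod p))) else 0)) ≠ 0 := by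
    intro i
    have hsum : (∑ s, t s * (if eS (x i) * φ' s (eS (y i)) * ψ' s (eS (z i)) = 1
        then (1 : FractionRing (Polynomial (ZMod p))) else 0)) = ∑ s ∈ Sol i, t s := by
      rw [Finset.sum_filter]
      exact Finset.sum_congr rfl fun s _ => by split_ifs <;> simp
    rw [hsum]
    exact ht i
  -- total weight `D = (p-1) Σ_a W_a`, threshold `tt = ⌈D/3⌉`
  set D : ℕ := (p - 1) * ∑ a, C.W a with hD
  set tt : ℕ := (D + 2) / 3 with htt
  have hcard := card_le_of_coprimeTwistedMatching C (K := FractionRing (Polynomial (ZMod p)))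
    hS' hT t φ' ψ' (fun i => eS (x i)) (fun i => eS (y i)) (fun i => eS (z i))
    (fun i j l s h => (hmatch' i j l).1 ⟨s, h⟩) hdiag tt tt
  have hcard' : (Fintype.card ι : ℝ) ≤
      ((Fintype.card {ex : ιA → Fin p // ∑ a, (ex a : ℕ) * C.W a < tt} : ℝ) +
      (Fintype.card {ex : ιA → Fin p // ∑ a, (ex a : ℕ) * C.W a < tt} : ℝ) +
      (Fintype.card {ex : ιA → Fin p // tt + tt ≤ ∑ a, (ex a : ℕ) * C.W a} : ℝ)) *
      (Fintype.card T : ℝ) := by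
    exact_mod_cast hcard
  have hdegle : ∀ ex : ιA → Fin p, ∑ a, (ex a : ℕ) * C.W a ≤ D := by
    intro ex
    rw [hD, Finset.mul_sum]
    exact Finset.sum_le_sum fun a _ => Nat.mul_le_mul_right _ (by have := (ex a).2; omega)
  -- the weights as reals
  let Wr : ιA → ℝ := fun a => ((C.W a : ℕ) : ℝ)
  have hWr : ∀ a, Wr a = ((p : ℝ) + 1) ^ C.lvl a := by
    intro a
    show (((p + 1) ^ C.lvl a : ℕ) : ℝ) = _
    push_cast; ring
  have hDr : (D : ℝ) = ((p - 1 : ℕ) : ℝ) * ∑ a, Wr a := by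
    rw [hD]; push_cast; rfl
  -- the per-coordinate factor and its bound
  let F : ιA → ℝ := fun a =>
    u ^ (-(((p - 1 : ℕ) : ℝ)) * Wr a / 3) * ∑ j : Fin p, u ^ (((j : ℕ) : ℝ) * Wr a)
  have hF : ∀ a, F a ≤ (p : ℝ) ^ c := by
    intro a
    have h1 := hθ (C.lvl a) (by rw [← hCL]; exact C.lvl_lt a)
    simp only [F, hWr]
    exact h1
  have hF0 : ∀ a, 0 ≤ F a := fun a =>
    mul_nonneg (Real.rpow_nonneg hu0.le _) (Finset.sum_nonneg fun j _ => Real.rpow_nonneg hu0.le _)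
  have hA : (Fintype.card ((i : κ) → Multiplicative (ZMod (n i))) : ℝ) =
      (p : ℝ) ^ Fintype.card ιA := by
    rw [← Nat.card_eq_fintype_card, C.card_eq]; push_cast; rfl
  have hprod : ∏ a, F a ≤ (Fintype.card ((i : κ) → Multiplicative (ZMod (n i))) : ℝ) ^ c := by
    calc ∏ a, F a ≤ ∏ _a : ιA, (p : ℝ) ^ c :=
          Finset.prod_le_prod (fun a _ => hF0 a) fun a _ => hF a
      _ = (Fintype.card ((i : κ) → Multiplicative (ZMod (n i))) : ℝ) ^ c := by
          rw [Finset.prod_const, Finset.card_univ, hA, ← Real.rpow_natCast ((p : ℝ) ^ c),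
            ← Real.rpow_mul hp0.le, mul_comm, Real.rpow_mul hp0.le, Real.rpow_natCast]
  have hprodF : ∏ a, F a = u ^ (-((D : ℝ) / 3)) * ∏ a, ∑ j : Fin p, u ^ (((j : ℕ) : ℝ) * Wr a) := by
    simp only [F]
    rw [Finset.prod_mul_distrib, ← Real.rpow_sum_of_pos hu0]
    congr 2
    rw [hDr, Finset.mul_sum, Finset.sum_div, ← Finset.sum_neg_distrib]
    refine Finset.sum_congr rfl fun a _ => by ring
  -- lower tail
  have hlow : (Fintype.card {ex : ιA → Fin p // ∑ a, (ex a : ℕ) * C.W a < tt} : ℝ) ≤ ∏ a, F a := by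
    have h1 := card_subtype_le_sum_rpow (fun ex : ιA → Fin p => ∑ a, (ex a : ℕ) * C.W a < tt)
      u hu0 (fun ex => -((D : ℝ) / 3) + 1 * ∑ a, ((ex a : ℕ) : ℝ) * Wr a) (fun ex hex => by
        refine Real.one_le_rpow_of_pos_of_le_one_of_nonpos hu0 hu1 ?_
        have h3 : 3 * ∑ a, (ex a : ℕ) * C.W a ≤ D := by omega
        have h4 : (3 : ℝ) * ∑ a, ((ex a : ℕ) : ℝ) * Wr a ≤ D := by
          show (3 : ℝ) * ∑ a, ((ex a : ℕ) : ℝ) * ((C.W a : ℕ) : ℝ) ≤ D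
          exact_mod_cast h3
        linarith)
    refine h1.trans (le_of_eq ?_)
    rw [sum_rpow_weighted p u hu0, hprodF]
    simp only [one_mul]
  -- upper tail
  have hhigh : (Fintype.card {ex : ιA → Fin p // tt + tt ≤ ∑ a, (ex a : ℕ) * C.W a} : ℝ) ≤
      ∏ a, F a := by
    have h1 := card_subtype_le_sum_rpow
      (fun ex : ιA → Fin p => tt + tt ≤ ∑ a, (ex a : ℕ) * C.W a)
      u hu0 (fun ex => 2 * (D : ℝ) / 3 + (-1) * ∑ a, ((ex a : ℕ) : ℝ) * Wr a) (fun ex hex => by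
        refine Real.one_le_rpow_of_pos_of_le_one_of_nonpos hu0 hu1 ?_
        have h3 : 2 * D ≤ 3 * ∑ a, (ex a : ℕ) * C.W a := by omega
        have h4 : (2 : ℝ) * D ≤ 3 * ∑ a, ((ex a : ℕ) : ℝ) * Wr a := by
          show (2 : ℝ) * D ≤ 3 * ∑ a, ((ex a : ℕ) : ℝ) * ((C.W a : ℕ) : ℝ)
          exact_mod_cast h3
        linarith)
    refine h1.trans (le_of_eq ?_)
    rw [sum_rpow_weighted p u hu0]
    have h2 : ∀ a, ∑ j : Fin p, u ^ (-1 * ((j : ℕ) : ℝ) * Wr a) =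
        u ^ (-(((p - 1 : ℕ) : ℝ)) * Wr a) * ∑ j : Fin p, u ^ (((j : ℕ) : ℝ) * Wr a) :=
      fun a => sum_rpow_neg_weighted p u hu0 (Wr a)
    simp_rw [h2]
    rw [Finset.prod_mul_distrib, ← Real.rpow_sum_of_pos hu0, ← mul_assoc, ← Real.rpow_add hu0,
      hprodF]
    congr 2
    rw [hDr, Finset.mul_sum, Finset.sum_div, Finset.mul_sum, Finset.sum_div,
      ← Finset.sum_add_distrib, ← Finset.sum_neg_distrib]
    refine Finset.sum_congr rfl fun a _ => by ring
  have hT0 : (0 : ℝ) ≤ Fintype.card T := Nat.cast_nonneg _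
  have hP0 : 0 ≤ ∏ a, F a := Finset.prod_nonneg fun a _ => hF0 a
  calc (Fintype.card ι : ℝ) ≤ _ := hcard'
    _ ≤ ((∏ a, F a) + (∏ a, F a) + ∏ a, F a) * (Fintype.card T : ℝ) := by gcongr
    _ = 3 * (Fintype.card T : ℝ) * ∏ a, F a := by ring
    _ ≤ 3 * (Fintype.card T : ℝ) *
        (Fintype.card ((i : κ) → Multiplicative (ZMod (n i))) : ℝ) ^ c := by gcongr

end EffectiveCoprime

end Summit.MatrixMultiplication.MatrixMultiplication.Theorems.TwistedSliceRank
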